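import Summits.QuantumFields.YangMills.Theorems.BalabanLadderIRTypLocalExcess
import Summits.QuantumFields.YangMills.Theorems.BalabanLadderIRFrameCells
import Summits.QuantumFields.YangMills.Theorems.BalabanLadderIRTypDilute
import Summits.QuantumFields.YangMills.Theorems.BalabanLadderIRTypAlgebra
import HarnessLib

/-!
# `Typ_lx^int`: frame covariance, closedness, compactness, measurability; the working class `diluteTyp ∩ Typ_lx^int`

Support file for crux `IR` = stmt-QuantumFields-19354 (route-QuantumFields-BalabanLadder), registered line «af-pincer-Uc»
(`pub/ym-beyond/p2-g28-files/line-af-pincer-Uc.reg.lean` b6e69d9662b5b07a).  Count-neutral helper (`--supports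
stmt-QuantumFields-19354`); it closes no stub.  Part 2 of 2 (part 1 = `…IRTypLocalExcess`: definitions, cell-locality, exact
interior immunity).

PROVENANCE.  PORT (route owner ruling R72, «lead's first move (1)») of the crux-ideate seat `ym-19354-certideate-1` GEN 10 desk
sketch `Sketch-g10.lean` (sha16 6da5ef98f9b9ac04) §4–§6, by the line's lead prover.  Change against the desk bytes: the slot's
`TypLocal w Typ` is spelled out as its two conjuncts `(∀ c, MeasurableSet (Typ c)) ∧ (∀ c, DependsOn (· ∈ Typ c) (cellEdges w c))`
(the slot's format module is not a tree module yet; the one-line bridge lands with it).  Everything else is the desk text.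

WHAT IS HERE.
* §4 frame covariance under the tree `shiftFrame` (`typLxInt_shiftFrame`; `FrameCovariant` = the crux-plan desk's predicate,
  verbatim shape; `frameCovariant_typLxInt`, `diluteTyp_shiftFrame`) — so clause (i) at every centre (`ClauseIAll`) costs a
  covariant supplier nothing beyond clause (i) at the centre on every frame;
* §5 each excess event is CLOSED (`isClosed_localExcess`: it is `{Φ ≤ pinnedInf Φ + E}` with `pinnedInf` continuous by
  Mathlib's `IsCompact.continuous_sInf` on the compact configuration space), hence `Typ_lx^int` is closed, compact and
  MEASURABLE (`isClosed_typLxInt`, `isCompact_typLxInt`, `measurableSet_typLxInt`; hypotheses `Continuous ρ`,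
  `SecondCountableTopology G` — the tree's standing ones);
* §6 the complete locality witness `typLocal_typLxInt`; the working class of the crux-plan desk (card `af-pincer` rev 7 move
  (1)) `WorkingClass ρ ℓ T Rs E w c := diluteTyp ρ w ℓ T c ∩ TypLxInt ρ w Rs E c`, `frameCovariant_workingClass`
  (with part 1's `diluteTyp_shiftFrame`), `typLocal_workingClass` (tree `measurableSet_diluteTyp` / `dependsOn_diluteTyp` /
  `IRRarityUpgrade.dependsOn_mem_inter`).

HONEST FRAMING: witness-conjunct bookkeeping for ONE candidate factor of ONE open stub's hypothesis format
(`stub_onsetUc : OnsetMixingTypicalUKPc`); clause (i) and the rarity target (A′) `SupCellRarityAt … WorkingClass …` are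
untouched; the chain above the crux is conditional; nothing here bears on the mass gap or the Clay problem.
All declarations proved (no `sorry`); axioms ⊆ {propext, Classical.choice, Quot.sound}.
-/

set_option autoImplicit false

noncomputable section

open MeasureTheory Set
open Literature.MathematicalPhysics
open Literature.MathematicalPhysics.QuantumFieldTheory Literature.MathematicalPhysics.QuantumLattice
open Literature.Probability.LatticeModels (Site)
open Summit.QuantumFields.YangMills.Cruxes.IR.Tempered (cellEdges)
open Summit.QuantumFields.YangMills.Theorems.OddTorusChessboard (cellSites cellPlaqs plaqAction)
open Summit.QuantumFields.YangMills.Cruxes.IR.CellTempered.Engine (shiftFrame cellEdges_shiftFrame)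
open Summit.QuantumFields.YangMills.Theorems.IRKernelLargeField (diluteTyp measurableSet_diluteTyp dependsOn_diluteTyp)
open Summit.QuantumFields.YangMills.Theorems.IRRarityUpgrade (dependsOn_mem_inter)

namespace Summit.QuantumFields.YangMills.Theorems.IRTypLocalExcess


section Covariance

variable {G : Type} [Group G] {N : ℕ} (ρ : G →* Matrix (Fin N) (Fin N) ℂ)

/-! ## §4 Frame covariance under the tree `shiftFrame` (slot U → Uc; cplan g7's `FrameCovariant`, verbatim shape) -/

omit [Group G] in
/-- The sites of cell `c` of the shifted frame are the sites of cell `c + x` of `w`. -/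
theorem cellSites_shiftFrame (w : Fin 4 → ℤ → ℤ) (x c : Fin 4 → ℤ) :
    cellSites (shiftFrame w x) c = cellSites w (c + x) := by
  simp only [cellSites, shiftFrame, Pi.add_apply, add_right_comm (c _) 1 (x _)]

omit [Group G] in
/-- The own plaquettes of cell `c` of the shifted frame are those of cell `c + x`. -/
theorem cellPlaqs_shiftFrame (w : Fin 4 → ℤ → ℤ) (x c : Fin 4 → ℤ) :
    cellPlaqs (shiftFrame w x) c = cellPlaqs w (c + x) := by
  unfold cellPlaqs
  rw [cellSites_shiftFrame]

omit [Group G] in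
/-- The relaxable links are frame-covariant. -/
theorem ballLinks_shiftFrame (w : Fin 4 → ℤ → ℤ) (x c : Fin 4 → ℤ) (R : ℕ) (y : Site 4) :
    ballLinks (shiftFrame w x) c R y = ballLinks w (c + x) R y := by
  unfold ballLinks
  rw [cellEdges_shiftFrame]

omit [Group G] in
/-- The touched own plaquettes are frame-covariant. -/
theorem touchedOwnPlaqs_shiftFrame (w : Fin 4 → ℤ → ℤ) (x c : Fin 4 → ℤ) (R : ℕ) (y : Site 4) :
    touchedOwnPlaqs (shiftFrame w x) c R y = touchedOwnPlaqs w (c + x) R y := by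
  unfold touchedOwnPlaqs
  rw [cellPlaqs_shiftFrame, ballLinks_shiftFrame]

/-- The own-Dirichlet functional is frame-covariant. -/
theorem dirichletAction_shiftFrame (w : Fin 4 → ℤ → ℤ) (x c : Fin 4 → ℤ) (R : ℕ) (y : Site 4) :
    dirichletAction ρ (shiftFrame w x) R c y = dirichletAction ρ w R (c + x) y := by
  funext U
  unfold dirichletAction
  rw [touchedOwnPlaqs_shiftFrame]

omit [Group G] in
/-- Interiority of a ball is frame-covariant. -/
theorem isInteriorBall_shiftFrame (w : Fin 4 → ℤ → ℤ) (x c : Fin 4 → ℤ) (R : ℕ) (y : Site 4) :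
    IsInteriorBall (shiftFrame w x) c R y = IsInteriorBall w (c + x) R y := by
  simp only [IsInteriorBall, cellSites_shiftFrame]

/-- The local-excess event is frame-covariant. -/
theorem localExcess_shiftFrame (w : Fin 4 → ℤ → ℤ) (x c : Fin 4 → ℤ) (R : ℕ) (E : ℝ) (y : Site 4)
    (U : LGConfig 4 G) :
    LocalExcess ρ (shiftFrame w x) R E c y U ↔ LocalExcess ρ w R E (c + x) y U := by
  unfold LocalExcess
  rw [dirichletAction_shiftFrame, ballLinks_shiftFrame]

/-- **PROVED — frame covariance of `Typ_lx^int`:** the class of cell `c` of the shifted frame IS the class of cell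
`c + x` of the original frame. -/
theorem typLxInt_shiftFrame (w : Fin 4 → ℤ → ℤ) (x : Fin 4 → ℤ) (Rs : Set ℕ) (E : ℕ → ℝ) (c : Fin 4 → ℤ) :
    TypLxInt ρ (shiftFrame w x) Rs E c = TypLxInt ρ w Rs E (c + x) := by
  ext U
  simp only [TypLxInt, Set.mem_setOf_eq, isInteriorBall_shiftFrame, localExcess_shiftFrame]

omit [Group G] in
/-- cplan g7's covariance predicate (`Sketch-g7-supplier-Uc.lean` 5b30fcf11d7560f0 §B, VERBATIM; desk bytes are not
importable): a frame-indexed family of cell classes is covariant under re-indexing of the frame. -/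
def FrameCovariant (Typ : (Fin 4 → ℤ → ℤ) → (Fin 4 → ℤ) → Set (LGConfig 4 G)) : Prop :=
  ∀ (w : Fin 4 → ℤ → ℤ) (x c : Fin 4 → ℤ), Typ (shiftFrame w x) c = Typ w (c + x)

omit [Group G] in
/-- cplan g7's `frameCovariant_inter` (VERBATIM): intersections of covariant families are covariant. -/
theorem frameCovariant_inter {A B : (Fin 4 → ℤ → ℤ) → (Fin 4 → ℤ) → Set (LGConfig 4 G)}
    (hA : FrameCovariant A) (hB : FrameCovariant B) : FrameCovariant (fun w c => A w c ∩ B w c) := by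
  intro w x c
  simp only [hA w x c, hB w x c]

/-- **PROVED — `Typ_lx^int` is `FrameCovariant`** in cplan's exact sense (so `clauseIAll_of_covariant` /
`typShellCondUKPc_of_covariant_supCellRarity` of their §B/§C apply to it: U^c's extra demand is free). -/
theorem frameCovariant_typLxInt (Rs : Set ℕ) (E : ℕ → ℝ) :
    FrameCovariant (fun w c => TypLxInt (G := G) ρ w Rs E c) :=
  fun w x c => typLxInt_shiftFrame ρ w x Rs E c

/-- The re-indexed family that `ClauseIAll` hands to the shifted frame is the class BUILT ON the shifted frame. -/
theorem typLxInt_reindex (w : Fin 4 → ℤ → ℤ) (c₀ : Fin 4 → ℤ) (Rs : Set ℕ) (E : ℕ → ℝ) :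
    (fun c => TypLxInt ρ w Rs E (c + c₀)) = TypLxInt ρ (shiftFrame w c₀) Rs E := by
  funext c
  exact (typLxInt_shiftFrame ρ w c₀ Rs E c).symm

/-- Covariance of the tree's dilute tier (cplan g7 `diluteTyp_shiftFrame`, re-proved here; 3 lines). -/
theorem diluteTyp_shiftFrame (w : Fin 4 → ℤ → ℤ) (x : Fin 4 → ℤ) (ℓ : ℕ) (T : ℝ) (c : Fin 4 → ℤ) :
    diluteTyp (G := G) ρ (shiftFrame w x) ℓ T c = diluteTyp ρ w ℓ T (c + x) := by
  ext σ
  simp only [Summit.QuantumFields.YangMills.Theorems.IRKernelLargeField.diluteTyp, Set.mem_setOf_eq,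
    cellSites_shiftFrame]

end Covariance

/-! ## §5 Closedness, compactness and measurability of `Typ_lx^int` (witness conjunct (w2), OWED since GEN 9) -/

section Measurability

variable {G : Type} [Group G] [TopologicalSpace G] [IsTopologicalGroup G] [CompactSpace G]
  [MeasurableSpace G] [BorelSpace G] {N : ℕ} (ρ : G →* Matrix (Fin N) (Fin N) ℂ)

omit [CompactSpace G] [MeasurableSpace G] [BorelSpace G] in
/-- The plaquette action of a continuous representation is continuous (tree `continuous_plaquetteObs`). -/
theorem continuous_plaqAction (hρ : Continuous ρ) (q : ZdPlaquette 4) : Continuous (plaqAction (G := G) ρ q) :=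
  continuous_const.sub (continuous_plaquetteObs ρ hρ q.1 q.2.1.1 q.2.1.2)

omit [CompactSpace G] [MeasurableSpace G] [BorelSpace G] in
/-- The own-Dirichlet functional is continuous. -/
theorem continuous_dirichletAction (hρ : Continuous ρ) (w : Fin 4 → ℤ → ℤ) (R : ℕ) (c : Fin 4 → ℤ) (x : Site 4) :
    Continuous (dirichletAction (G := G) ρ w R c x) := by
  unfold dirichletAction
  exact continuous_finsetSum _ fun q _ => continuous_plaqAction ρ hρ q

omit [Group G] [IsTopologicalGroup G] [CompactSpace G] [MeasurableSpace G] [BorelSpace G] in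
/-- The splice is jointly continuous in (exterior, interior). -/
theorem continuous_spliceOn (S : Finset (QuantumLattice.ZdEdge 4)) :
    Continuous fun p : LGConfig 4 G × LGConfig 4 G => spliceOn S p.2 p.1 := by
  refine continuous_pi fun e => ?_
  by_cases he : e ∈ S
  · simp only [spliceOn, if_pos he]
    exact (continuous_apply e).comp continuous_snd
  · simp only [spliceOn, if_neg he]
    exact (continuous_apply e).comp continuous_fst

omit [Group G] [TopologicalSpace G] [IsTopologicalGroup G] [CompactSpace G] [MeasurableSpace G] [BorelSpace G] in
/-- The infimum of `Φ` over the pinned class of `U` off `S`, parametrised by the splice over the WHOLE (compact)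
configuration space — no attainment / nonemptiness bookkeeping leaks into statements. -/
def pinnedInf (Φ : LGConfig 4 G → ℝ) (S : Finset (QuantumLattice.ZdEdge 4)) (U : LGConfig 4 G) : ℝ :=
  sInf ((fun V' : LGConfig 4 G => Φ (spliceOn S V' U)) '' univ)

omit [Group G] [IsTopologicalGroup G] [MeasurableSpace G] [BorelSpace G] in
/-- **Continuity of the pinned infimum** (Mathlib `IsCompact.continuous_sInf` on the compact configuration space). -/
theorem continuous_pinnedInf {Φ : LGConfig 4 G → ℝ} (hΦ : Continuous Φ) (S : Finset (QuantumLattice.ZdEdge 4)) :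
    Continuous (pinnedInf Φ S) := by
  have h2 : Continuous (↿(fun (U V' : LGConfig 4 G) => Φ (spliceOn S V' U))) :=
    hΦ.comp (continuous_spliceOn S)
  exact (isCompact_univ (X := LGConfig 4 G)).continuous_sInf h2

omit [Group G] [IsTopologicalGroup G] [MeasurableSpace G] [BorelSpace G] in
/-- The image of the pinned class under a continuous functional is bounded below (compactness). -/
theorem bddBelow_pinned_image {Φ : LGConfig 4 G → ℝ} (hΦ : Continuous Φ) (S : Finset (QuantumLattice.ZdEdge 4)) (U : LGConfig 4 G) :
    BddBelow ((fun V' : LGConfig 4 G => Φ (spliceOn S V' U)) '' univ) := by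
  have hc : Continuous fun V' : LGConfig 4 G => Φ (spliceOn S V' U) :=
    hΦ.comp ((continuous_spliceOn S).comp (Continuous.prodMk_right U))
  exact (isCompact_univ.image hc).bddBelow

omit [IsTopologicalGroup G] [MeasurableSpace G] [BorelSpace G] in
/-- **The junk-free excess event as a closed condition:** `LocalExcess … x U ↔ Φ_x U ≤ pinnedInf Φ_x S_x U + E`. -/
theorem localExcess_iff {w : Fin 4 → ℤ → ℤ} {R : ℕ} {E : ℝ} {c : Fin 4 → ℤ} {x : Site 4}
    (hΦ : Continuous (dirichletAction (G := G) ρ w R c x)) (U : LGConfig 4 G) :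
    LocalExcess ρ w R E c x U ↔
      dirichletAction ρ w R c x U ≤ pinnedInf (dirichletAction ρ w R c x) (ballLinks w c R x) U + E := by
  have hne : ((fun V' : LGConfig 4 G =>
      dirichletAction ρ w R c x (spliceOn (ballLinks w c R x) V' U)) '' univ).Nonempty :=
    ⟨_, mem_image_of_mem _ (mem_univ U)⟩
  constructor
  · intro h
    have hle : dirichletAction ρ w R c x U - E ≤
        pinnedInf (dirichletAction ρ w R c x) (ballLinks w c R x) U := by
      refine le_csInf hne ?_
      rintro y ⟨V', -, rfl⟩
      have := h (spliceOn (ballLinks w c R x) V' U) (spliceOn_mem_pinnedOff _ V' U)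
      linarith
    linarith
  · intro h V hV
    have hmem : dirichletAction ρ w R c x V ∈
        (fun V' : LGConfig 4 G => dirichletAction ρ w R c x (spliceOn (ballLinks w c R x) V' U)) '' univ :=
      ⟨V, mem_univ V, congrArg (dirichletAction ρ w R c x) (spliceOn_eq_of_mem_pinnedOff hV)⟩
    have hinf : pinnedInf (dirichletAction ρ w R c x) (ballLinks w c R x) U ≤ dirichletAction ρ w R c x V :=
      csInf_le (bddBelow_pinned_image hΦ _ U) hmem
    linarith

omit [IsTopologicalGroup G] [MeasurableSpace G] [BorelSpace G] in
/-- **PROVED — each excess event is CLOSED.** -/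
theorem isClosed_localExcess {w : Fin 4 → ℤ → ℤ} {R : ℕ} (E : ℝ) {c : Fin 4 → ℤ} {x : Site 4}
    (hΦ : Continuous (dirichletAction (G := G) ρ w R c x)) :
    IsClosed {U : LGConfig 4 G | LocalExcess ρ w R E c x U} := by
  have hset : {U : LGConfig 4 G | LocalExcess ρ w R E c x U} =
      {U | dirichletAction ρ w R c x U ≤ pinnedInf (dirichletAction ρ w R c x) (ballLinks w c R x) U + E} := by
    ext U
    exact localExcess_iff ρ hΦ U
  rw [hset]
  exact isClosed_le hΦ ((continuous_pinnedInf hΦ _).add continuous_const)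

omit [Group G] [IsTopologicalGroup G] [CompactSpace G] [MeasurableSpace G] [BorelSpace G] in
/-- A guarded event `{U | P → Q U}` is closed when `{U | Q U}` is. -/
private theorem isClosed_setOf_imp (P : Prop) {Q : LGConfig 4 G → Prop} (hQ : IsClosed {U | Q U}) :
    IsClosed {U : LGConfig 4 G | P → Q U} := by
  by_cases hP : P
  · have : {U : LGConfig 4 G | P → Q U} = {U | Q U} := by ext U; simp [hP]
    rw [this]; exact hQ
  · have : {U : LGConfig 4 G | P → Q U} = univ := by ext U; simp [hP]
    rw [this]; exact isClosed_univ

omit [TopologicalSpace G] [IsTopologicalGroup G] [CompactSpace G] [MeasurableSpace G] [BorelSpace G] in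
/-- `Typ_lx^int` as a countable intersection of guarded excess events. -/
theorem typLxInt_eq_iInter (w : Fin 4 → ℤ → ℤ) (Rs : Set ℕ) (E : ℕ → ℝ) (c : Fin 4 → ℤ) :
    TypLxInt (G := G) ρ w Rs E c =
      ⋂ R : ℕ, ⋂ x : Site 4, {U | R ∈ Rs → IsInteriorBall w c R x → LocalExcess ρ w R (E R) c x U} := by
  ext U
  simp only [TypLxInt, Set.mem_setOf_eq, Set.mem_iInter]

omit [MeasurableSpace G] [BorelSpace G] in
/-- **PROVED — `Typ_lx^int` is CLOSED** (hence compact): usable verbatim in weak-limit / portmanteau passages. -/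
theorem isClosed_typLxInt (hρ : Continuous ρ) (w : Fin 4 → ℤ → ℤ) (Rs : Set ℕ) (E : ℕ → ℝ) (c : Fin 4 → ℤ) :
    IsClosed (TypLxInt (G := G) ρ w Rs E c) := by
  rw [typLxInt_eq_iInter]
  exact isClosed_iInter fun R => isClosed_iInter fun x =>
    isClosed_setOf_imp _ (isClosed_setOf_imp _ (isClosed_localExcess ρ (E R) (continuous_dirichletAction ρ hρ w R c x)))

omit [MeasurableSpace G] [BorelSpace G] in
/-- `Typ_lx^int` is compact. -/
theorem isCompact_typLxInt (hρ : Continuous ρ) (w : Fin 4 → ℤ → ℤ) (Rs : Set ℕ) (E : ℕ → ℝ) (c : Fin 4 → ℤ) :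
    IsCompact (TypLxInt (G := G) ρ w Rs E c) :=
  (isClosed_typLxInt ρ hρ w Rs E c).isCompact

variable [SecondCountableTopology G]

/-- **PROVED — witness conjunct (w2): `Typ_lx^int` is measurable** (closed in the countable product of second-countable
Borel spaces), under the tree's standing hypotheses (`Continuous ρ`, `SecondCountableTopology G`). -/
theorem measurableSet_typLxInt (hρ : Continuous ρ) (w : Fin 4 → ℤ → ℤ) (Rs : Set ℕ) (E : ℕ → ℝ) (c : Fin 4 → ℤ) :
    MeasurableSet (TypLxInt (G := G) ρ w Rs E c) :=
  (isClosed_typLxInt ρ hρ w Rs E c).measurableSet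

/-! ## §6 Slot packaging: the two `TypLocal` conjuncts, and the working class `diluteTyp ∩ Typ_lx^int` (cplan rev 7 move (1))

(The slot's `AfPincerUc.TypLocal w Typ` is by definition the conjunction proved here; the one-line bridge lands with the
slot's format module.) -/

/-- **PROVED — `Typ_lx^int` is a COMPLETE `TypLocal` witness** (both conjuncts of the slot's `TypLocal`; every frame,
scale set, budget). -/
theorem typLocal_typLxInt (hρ : Continuous ρ) (w : Fin 4 → ℤ → ℤ) (Rs : Set ℕ) (E : ℕ → ℝ) :
    (∀ c, MeasurableSet (TypLxInt (G := G) ρ w Rs E c)) ∧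
      (∀ c, DependsOn (fun σ : LGConfig 4 G => σ ∈ TypLxInt ρ w Rs E c) ↑(cellEdges w c)) :=
  ⟨fun c => measurableSet_typLxInt ρ hρ w Rs E c, fun c => typLxInt_dependsOn ρ w Rs E c⟩

/-- **The working class of cplan rev 7 move (1):** `diluteTyp(ℓ, T) ∩ Typ_lx^int(Rs, E)`, frame-indexed. -/
def WorkingClass (ℓ : ℕ) (T : ℝ) (Rs : Set ℕ) (E : ℕ → ℝ) (w : Fin 4 → ℤ → ℤ) (c : Fin 4 → ℤ) :
    Set (LGConfig 4 G) :=
  diluteTyp ρ w ℓ T c ∩ TypLxInt ρ w Rs E c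

omit [SecondCountableTopology G] [TopologicalSpace G] [IsTopologicalGroup G] [CompactSpace G] [MeasurableSpace G]
  [BorelSpace G] in
/-- **PROVED — the working class is `FrameCovariant`.** -/
theorem frameCovariant_workingClass (ℓ : ℕ) (T : ℝ) (Rs : Set ℕ) (E : ℕ → ℝ) :
    FrameCovariant (WorkingClass (G := G) ρ ℓ T Rs E) :=
  frameCovariant_inter (fun w x c => diluteTyp_shiftFrame ρ w x ℓ T c) (frameCovariant_typLxInt ρ Rs E)

/-- **PROVED — the working class is a complete `TypLocal` witness on every frame** (tree `measurableSet_diluteTyp`,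
`dependsOn_diluteTyp`, `IRRarityUpgrade.dependsOn_mem_inter`, and §5/§2 above). -/
theorem typLocal_workingClass (hρ : Continuous ρ) (ℓ : ℕ) (T : ℝ) (Rs : Set ℕ) (E : ℕ → ℝ) (w : Fin 4 → ℤ → ℤ) :
    (∀ c, MeasurableSet (WorkingClass (G := G) ρ ℓ T Rs E w c)) ∧
      (∀ c, DependsOn (fun σ : LGConfig 4 G => σ ∈ WorkingClass ρ ℓ T Rs E w c) ↑(cellEdges w c)) :=
  ⟨fun c => (measurableSet_diluteTyp ρ hρ w ℓ T c).inter (measurableSet_typLxInt ρ hρ w Rs E c),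
    fun c => dependsOn_mem_inter (dependsOn_diluteTyp ρ w ℓ T c) (typLxInt_dependsOn ρ w Rs E c)⟩

end Measurability

end Summit.QuantumFields.YangMills.Theorems.IRTypLocalExcess

end
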